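import Summits.FinalStateConjecture.FinalStateConjecture.Theorems.EIHFluxBalanceInertialRecessionStubChargeModelKSCharge
import Summits.FinalStateConjecture.FinalStateConjecture.Theorems.EIHFluxBalanceLLSphericalChart
import Summits.FinalStateConjecture.FinalStateConjecture.Theorems.EIHFluxBalanceInertialRecessionStubWindowChargesSphere

/-!
# Route EIHFluxBalance — `InertialRecession`, line `sublinear-is-free-clean-window-charges`:
# the area of coordinate spheres and the Landau–Lifshitz energy of a Schwarzschild sphere
# (helpers for `stub_chargeModel`, identification half)

Helper file (`--supports stmt-FinalStateConjecture-10166`) for the crux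
`Summit.FinalStateConjecture.FinalStateConjecture.Theses.EIHFluxBalance.InertialRecession`.

* `setIntegral_sphBox_sin` — `∫_{(0,π)×(−π,π)} sin θ d(θ,φ) = 4π` (Fubini along `E2 ≃ᵐ ℝ × ℝ`);
* `setIntegral_sphere_const`, `euclideanHausdorff_sphere` — **the area of the coordinate sphere**:
  `∮_{|y|=ρ} c dμHE[2] = 4πρ² c` and `μHE[2]({|y| = ρ}) = 4πρ²` (area formula of `…LLSphericalChart`);
* `quasiLocalMomentum_schwarzschild_energy` — **the quasi-local Landau–Lifshitz ENERGY of every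
  coordinate sphere about a Schwarzschild hole is exactly its mass**: `P⁰(t; 0, R) = M` for the
  Kerr–Schild components `g_{M,0}` and every `R > 0`, `t` (LL §96/(105.x): the flux density is the
  constant `M/(4πR²)`, `…KSCharge`).
-/

set_option linter.dupNamespace false

noncomputable section

open MeasureTheory MeasureTheory.Measure Set Metric Real
open scoped ENNReal
open Literature.Geometry.Lorentzian Literature.Geometry.Lorentzian.LandauLifshitz

namespace Summit.FinalStateConjecture.FinalStateConjecture.Theorems

namespace KSCharge

/-- The parameter plane of spherical coordinates. -/
local notation "E2" => EuclideanSpace ℝ (Fin 2)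

/-! ### The total solid angle -/

/-- **`∫_{(0,π)×(−π,π)} sin θ d(θ, φ) = 4π`** (Fubini along the measure-preserving equivalence
`E2 ≃ᵐ ℝ × ℝ`, `∫₀^π sin = 2`, `|(-π, π)| = 2π`). [folklore] -/
theorem setIntegral_sphBox_sin :
    ∫ p in {p : E2 | p 0 ∈ Ioo 0 π ∧ p 1 ∈ Ioo (-π) π}, Real.sin (p 0) = 4 * π := by
  set e : E2 ≃ᵐ ℝ × ℝ := (MeasurableEquiv.toLp 2 (Fin 2 → ℝ)).symm.trans (MeasurableEquiv.finTwoArrow) with he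
  have hpres : MeasurePreserving e volume volume :=
    (EuclideanSpace.volume_preserving_symm_measurableEquiv_toLp (Fin 2)).trans
      (MeasureTheory.volume_preserving_finTwoArrow ℝ)
  have he1 : ∀ p : E2, (e p).1 = p 0 := fun p ↦ by simp [he]
  have he2 : ∀ p : E2, (e p).2 = p 1 := fun p ↦ by simp [he]
  have hpre : e ⁻¹' (Ioo 0 π ×ˢ Ioo (-π) π) = {p : E2 | p 0 ∈ Ioo 0 π ∧ p 1 ∈ Ioo (-π) π} := by
    ext p
    simp only [mem_preimage, mem_prod, mem_setOf_eq, he1, he2]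
  calc ∫ p in {p : E2 | p 0 ∈ Ioo 0 π ∧ p 1 ∈ Ioo (-π) π}, Real.sin (p 0)
      = ∫ p in e ⁻¹' (Ioo 0 π ×ˢ Ioo (-π) π), (fun z : ℝ × ℝ ↦ Real.sin z.1 * (fun _ : ℝ ↦ (1 : ℝ)) z.2) (e p) := by
        rw [hpre]
        refine setIntegral_congr_fun LLSphere.measurableSet_sphBox fun p _ ↦ ?_
        simp [he1]
    _ = ∫ z in Ioo 0 π ×ˢ Ioo (-π) π, Real.sin z.1 * (fun _ : ℝ ↦ (1 : ℝ)) z.2 :=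
        hpres.setIntegral_preimage_emb e.measurableEmbedding
          (fun z : ℝ × ℝ ↦ Real.sin z.1 * (fun _ : ℝ ↦ (1 : ℝ)) z.2) (Ioo 0 π ×ˢ Ioo (-π) π)
    _ = (∫ θ in Ioo 0 π, Real.sin θ) * ∫ _φ in Ioo (-π) π, (1 : ℝ) := by
        rw [Measure.volume_eq_prod]
        exact setIntegral_prod_mul (fun θ ↦ Real.sin θ) (fun _ ↦ (1 : ℝ)) (Ioo 0 π) (Ioo (-π) π)
    _ = 2 * (2 * π) := by
        congr 1
        · rw [← intervalIntegral.integral_of_le pi_pos.le |>.trans (setIntegral_congr_set Ioo_ae_eq_Ioc.symm),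
            integral_sin, Real.cos_zero, Real.cos_pi]
          ring
        · rw [setIntegral_const, smul_eq_mul, mul_one, Measure.real, Real.volume_Ioo,
            ENNReal.toReal_ofReal (by linarith [pi_pos])]
          ring
    _ = 4 * π := by ring

/-! ### The area of coordinate spheres -/

/-- **Integral of a constant over a coordinate sphere**: `∮_{|y| = ρ} c dμHE[2] = 4πρ² c` for `ρ > 0`
(area formula `setIntegral_sphere_eq_setIntegral_sphBox`). [cite: Federer1969, 3.2.5] -/
theorem setIntegral_sphere_const {ρ : ℝ} (hρ : 0 < ρ) (c : ℝ) :
    ∫ _y in sphere (0 : E3) ρ, c ∂(μHE[2] : Measure E3) = 4 * π * ρ ^ 2 * c := by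
  rw [LLSphere.setIntegral_sphere_eq_setIntegral_sphBox hρ (fun _ ↦ c)]
  have h : ∀ p : E2, ρ ^ 2 * Real.sin (p 0) * c = (ρ ^ 2 * c) * Real.sin (p 0) := fun p ↦ by ring
  simp_rw [h, integral_const_mul, setIntegral_sphBox_sin]
  ring

/-- **The area of the coordinate sphere**: `μHE[2]({|y| = ρ}) = 4πρ²` (`ρ > 0`), as a real number.
[cite: Federer1969, 3.2.5] -/
theorem euclideanHausdorff_sphere_toReal {ρ : ℝ} (hρ : 0 < ρ) :
    ((μHE[2] : Measure E3) (sphere (0 : E3) ρ)).toReal = 4 * π * ρ ^ 2 := by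
  have h := setIntegral_sphere_const hρ 1
  rw [setIntegral_const, smul_eq_mul, mul_one, mul_one, Measure.real] at h
  exact h

/-- Translated form: `μHE[2]({|y − ξ| = ρ}) = 4πρ²`. [cite: Federer1969, 3.2.5] -/
theorem euclideanHausdorff_sphere_toReal' (ξ : E3) {ρ : ℝ} (hρ : 0 < ρ) :
    ((μHE[2] : Measure E3) (sphere ξ ρ)).toReal = 4 * π * ρ ^ 2 := by
  have h : ∫ _y in sphere ξ ρ, (1 : ℝ) ∂(μHE[2] : Measure E3) = ∫ _y in sphere (0 : E3) ρ, (1 : ℝ) ∂(μHE[2] : Measure E3) :=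
    SublinearIsFree.WindowCharges.setIntegral_sphere_translate (fun _ ↦ (1 : ℝ)) ξ ρ
  rw [setIntegral_const, setIntegral_const, smul_eq_mul, smul_eq_mul, mul_one, mul_one, Measure.real,
    Measure.real, euclideanHausdorff_sphere_toReal hρ] at h
  exact h

/-! ### The Landau–Lifshitz energy of a Schwarzschild sphere -/

/-- **The quasi-local Landau–Lifshitz energy of every coordinate sphere about a Schwarzschild hole is
its mass**: for the Kerr–Schild components `g_{M,0}` (static hole at the spatial origin), every lab time
`t` and every radius `R > 0`, `P⁰(t; 0, R) = ∮ Σⱼ h^{00j} nⱼ dσ = (M/(4πR²)) · 4πR² = M`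
(LL §96, (96.16), with §105). [cite: LandauLifshitz1975, §96 (96.16)] -/
theorem quasiLocalMomentum_schwarzschild_energy (M t : ℝ) {R : ℝ} (hR : 0 < R) :
    quasiLocalMomentum (fun y ↦ Kerr.bilin M 0 y) t 0 R 0 = M := by
  rw [quasiLocalMomentum]
  have hcongr : ∀ y ∈ sphere (0 : E3) R,
      ∑ j : Fin 3, hField (fun z ↦ Kerr.bilin M 0 z) (E4.ofTimeSpace t y) 0 0 j.succ * (y - 0) j / R =
        M / (4 * π * R ^ 2) := fun y hy ↦
    sum_hField_schwarzschild_energy_sphere M t hR (mem_sphere_zero_iff_norm.1 hy)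
  rw [setIntegral_congr_fun isClosed_sphere.measurableSet hcongr, setIntegral_sphere_const hR]
  have hπ : π ≠ 0 := pi_ne_zero
  field_simp

end KSCharge

/-- Registered sub-goal form (stub `quasiLocalEnergy_schwarzschild_eq_mass` of the crux item) of
`KSCharge.quasiLocalMomentum_schwarzschild_energy`: the Landau–Lifshitz quasi-local energy of every
coordinate sphere about a static Schwarzschild hole (Kerr–Schild components) equals its mass.
[cite: LandauLifshitz1975, §96 (96.16)] -/
theorem quasiLocalEnergy_schwarzschild_eq_mass : open Literature.Geometry.Lorentzian in ∀ (M t : ℝ) {R : ℝ}, 0 < R → LandauLifshitz.quasiLocalMomentum (fun y ↦ Kerr.bilin M 0 y) t 0 R 0 = M :=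
  fun M t _ hR ↦ KSCharge.quasiLocalMomentum_schwarzschild_energy M t hR

end Summit.FinalStateConjecture.FinalStateConjecture.Theorems

end
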